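import Literature.Analysis.FluidPDE.NSRegFourierSolution
import HarnessLib

/-!
# The two-time weak formulation of classical (regularised) Navier–Stokes solutions

Eleventh file of the Fourier-side construction of the global regular solution of the
Leray-regularised Navier–Stokes system (discharge of
`Literature.Analysis.FluidPDE.leray_regularised_wellposed`).

* `IsClassicalNSSolutionOn.integral_inner_sub_eq` — for a classical solution of the Navier–Stokes
  system with force `f` on `[0, T] × E`, a space–time test field `ψ` with divergence-free slices
  and `0 ≤ s ≤ t ≤ T`:
  `∫⟪u(t), ψ(t)⟫ − ∫⟪u(s), ψ(s)⟫ = ∫ₛᵗ ∫ (⟪u, ∂ₜψ⟫ + ⟪u, (u·∇)ψ⟫ + ν⟪u, Δψ⟫ + ⟪f, ψ⟫) dx dτ`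
  (the slice identity `IsClassicalNSSolutionOn.integral_inner_timeDerivWithin_test`, the
  fundamental theorem of calculus on each time line `τ ↦ ⟪u(τ,x), ψ(τ,x)⟫`, and Fubini on
  `(s, t) × E`; Leray 1934, §III, derivation of (17) p. 206 and (3.2) p. 219);
* `RegSetup.regularised` — for the regularised solution of `NSRegFourierSolution` (force
  `f = (u·∇)u − (Ju·∇)u`) the convective terms recombine by integration by parts
  (`integral_inner_convect_add_eq_zero`, `div u = div Ju = 0`) into Leray's regularised weak form
  `∫⟪u(t), ψ(t)⟫ − ∫⟪u(s), ψ(s)⟫ = ∫ₛᵗ ∫ (⟪u, ∂ₜψ⟫ + ⟪u, (Ju·∇)ψ⟫ + ν⟪u, Δψ⟫)`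
  (Leray 1934, Ch. V §26, relation (5.1) paired with a test field).

## References

* J. Leray, Acta Math. 63 (1934), §III (17) p. 206, §17 (3.2), Ch. V §26 (5.1). [Leray1934]
* W. S. Ożański, B. C. Pooley, LMS Lecture Note Ser. 452 (2018), Thm. 6.33. [OzanskiPooley2018]
-/

noncomputable section

open MeasureTheory Real Set Filter Topology Function TopologicalSpace
open scoped RealInnerProductSpace ENNReal ContDiff Laplacian

namespace Literature.Analysis.FluidPDE

section General

variable {E : Type*} [NormedAddCommGroup E] [InnerProductSpace ℝ E] [FiniteDimensional ℝ E]
  [MeasurableSpace E] [BorelSpace E]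
variable {T ν : ℝ} {f u : ℝ → E → E} {p : ℝ → E → ℝ}

/-- **The two-time weak formulation of a classical solution.** For a classical solution of the
Navier–Stokes system with force `f` on `[0, T] × E`, a space–time test field `ψ` with
divergence-free slices and `0 ≤ s ≤ t ≤ T`,
`∫⟪u(t), ψ(t)⟫ − ∫⟪u(s), ψ(s)⟫ = ∫ₛᵗ ∫ (⟪u, ∂ₜψ⟫ + ⟪u, (u·∇)ψ⟫ + ν⟪u, Δψ⟫ + ⟪f, ψ⟫) dx dτ`
(Leray 1934, §III (17) and §17 (3.2)). [folklore] -/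
theorem IsClassicalNSSolutionOn.integral_inner_sub_eq (h : IsClassicalNSSolutionOn (Icc 0 T) ν f u p) (hT : 0 < T)
    {ψ : ℝ → E → E} (hψ : IsSpaceTimeTestOn (⊤ : Opens (ℝ × E)) ψ) (hdiv : ∀ τ, VectorCalculus.IsDivFree (ψ τ))
    {s t : ℝ} (hs : 0 ≤ s) (hst : s ≤ t) (ht : t ≤ T) :
    (∫ x, ⟪u t x, ψ t x⟫) - ∫ x, ⟪u s x, ψ s x⟫ =
      ∫ τ in s..t, ∫ x, (⟪u τ x, timeDeriv ψ τ x⟫ + ⟪u τ x, convect (u τ) (ψ τ) x⟫ +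
        ν * ⟪u τ x, (Δ (ψ τ)) x⟫ + ⟪f τ x, ψ τ x⟫) := by
  have hU : UniqueDiffOn ℝ (Icc 0 T) := uniqueDiffOn_Icc hT
  have hu_cont : ContinuousOn (uncurry u) (Icc 0 T ×ˢ univ) := h.smooth_velocity.continuousOn
  have hdt_cont : ContinuousOn (uncurry (timeDerivWithin (Icc 0 T) u)) (Icc 0 T ×ˢ univ) :=
    (h.smooth_velocity.timeDerivWithin hU).continuousOn
  have hψc : Continuous (uncurry ψ) := hψ.contDiff.continuous
  have hψtc : Continuous (uncurry (timeDeriv ψ)) := hψ.continuous_timeDeriv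
  obtain ⟨K, hK, hKt⟩ := hψ.exists_compact_slice_subset
  have hψK : ∀ τ, ∀ x ∉ K, ψ τ x = 0 := fun τ x hx => image_eq_zero_of_notMem_tsupport fun h' => hx (hKt τ h')
  have hψtK : ∀ τ, ∀ x ∉ K, timeDeriv ψ τ x = 0 := fun τ x hx => timeDeriv_eq_zero_of_forall (fun σ => hψK σ x hx) τ
  have hsub : Icc s t ×ˢ (univ : Set E) ⊆ Icc 0 T ×ˢ univ := prod_mono (Icc_subset_Icc hs ht) Subset.rfl
  -- the integrand `G = ⟪∂ₜu, ψ⟫ + ⟪u, ∂ₜψ⟫` and its integrability on `(s, t) × E`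
  set G : ℝ × E → ℝ := fun z => ⟪timeDerivWithin (Icc 0 T) u z.1 z.2, ψ z.1 z.2⟫ + ⟪u z.1 z.2, timeDeriv ψ z.1 z.2⟫ with hG
  have hGcont : ContinuousOn G (Icc s t ×ˢ univ) :=
    ((hdt_cont.mono hsub).inner hψc.continuousOn).add ((hu_cont.mono hsub).inner hψtc.continuousOn)
  have hGK : ∀ τ ∈ Icc s t, ∀ x ∉ K, G (τ, x) = 0 := fun τ _ x hx => by
    simp only [hG, hψK τ x hx, hψtK τ x hx, inner_zero_right, add_zero]
  have hGint := integrable_prod_of_continuousOn hK hGcont hGK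
  -- the fundamental theorem of calculus on each time line
  have htI : t ∈ Icc 0 T := ⟨hs.trans hst, ht⟩
  have hsI : s ∈ Icc 0 T := ⟨hs, hst.trans ht⟩
  have hline : ∀ x, ∫ τ in Ioo s t, G (τ, x) = ⟪u t x, ψ t x⟫ - ⟪u s x, ψ s x⟫ := by
    intro x
    rcases eq_or_lt_of_le hst with rfl | hst'
    · simp
    have hcont : ContinuousOn (fun τ => ⟪u τ x, ψ τ x⟫) (Icc s t) :=
      (hu_cont.comp (Continuous.prodMk_left x).continuousOn fun τ hτ => mk_mem_prod (Icc_subset_Icc hs ht hτ) (mem_univ x)).inner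
        (hψc.comp (Continuous.prodMk_left x)).continuousOn
    have hderiv : ∀ τ ∈ Ioo s t, HasDerivWithinAt (fun τ => ⟪u τ x, ψ τ x⟫) (G (τ, x)) (Ioi τ) τ := by
      intro τ hτ
      have hτ0 : τ ∈ Ioo 0 T := ⟨hs.trans_lt hτ.1, hτ.2.trans_le ht⟩
      have hu' : HasDerivAt (fun σ => u σ x) (timeDerivWithin (Icc 0 T) u τ x) τ :=
        (h.smooth_velocity.hasDerivWithinAt_timeDerivWithin hU (Ioo_subset_Icc_self hτ0) x).hasDerivAt
          (Icc_mem_nhds hτ0.1 hτ0.2)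
      have hψ' : HasDerivAt (fun σ => ψ σ x) (timeDeriv ψ τ x) τ := hψ.hasDerivAt_time τ x
      have h2 := (hu'.inner ℝ hψ').hasDerivWithinAt (s := Ioi τ)
      refine h2.congr_deriv ?_
      simp only [hG]
      rw [add_comm, real_inner_comm (ψ τ x)]
    have hint : IntervalIntegrable (fun τ => G (τ, x)) volume s t := by
      refine ContinuousOn.intervalIntegrable ?_
      rw [uIcc_of_le hst]
      exact hGcont.comp (Continuous.prodMk_left x).continuousOn fun τ hτ => mk_mem_prod hτ (mem_univ x)
    have := intervalIntegral.integral_eq_sub_of_hasDeriv_right_of_le hst hcont hderiv hint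
    rw [intervalIntegral.integral_of_le hst, integral_Ioc_eq_integral_Ioo] at this
    rw [this]
  -- integrate over `x` and swap
  have hslice : ∀ {r : ℝ}, r ∈ Icc 0 T → Integrable (fun x => ⟪u r x, ψ r x⟫) (volume : Measure E) := fun {r} hr =>
    integrable_inner_of_hasCompactSupport_right (h.contDiff_velocity hr).continuous
      (hψc.comp (Continuous.prodMk_right r)) (hψ.hasCompactSupport_slice r)
  have hLHS : (∫ x, ⟪u t x, ψ t x⟫) - ∫ x, ⟪u s x, ψ s x⟫ = ∫ τ in Ioo s t, ∫ x, G (τ, x) := by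
    rw [← integral_sub (hslice htI) (hslice hsI), integral_integral_swap (f := fun τ x => G (τ, x)) hGint]
    exact integral_congr_ae (Eventually.of_forall fun x => (hline x).symm)
  rw [hLHS, intervalIntegral.integral_of_le hst, integral_Ioc_eq_integral_Ioo]
  -- the slice identity, for `τ ∈ (s, t)`
  refine setIntegral_congr_fun measurableSet_Ioo fun τ hτ => ?_
  have hτI : τ ∈ Icc 0 T := ⟨hs.trans hτ.1.le, hτ.2.le.trans ht⟩
  have hψ2 : ContDiff ℝ 2 (ψ τ) := (hψ.contDiff.comp (contDiff_prodMk_right τ)).of_le (by norm_cast)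
  have hslice_id := h.integral_inner_timeDerivWithin_test hU hτI hψ2 (hψ.hasCompactSupport_slice τ) (hdiv τ)
  have huc : Continuous (u τ) := (h.contDiff_velocity hτI).continuous
  have hdtc : Continuous (timeDerivWithin (Icc 0 T) u τ) := ((h.smooth_velocity.timeDerivWithin hU).contDiff_slice hτI).continuous
  have i1 : Integrable (fun x => ⟪timeDerivWithin (Icc 0 T) u τ x, ψ τ x⟫) (volume : Measure E) :=
    integrable_inner_of_hasCompactSupport_right hdtc (hψc.comp (Continuous.prodMk_right τ)) (hψ.hasCompactSupport_slice τ)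
  have i2 : Integrable (fun x => ⟪u τ x, timeDeriv ψ τ x⟫) (volume : Measure E) :=
    integrable_inner_of_hasCompactSupport_right huc (hψtc.comp (Continuous.prodMk_right τ))
      (HasCompactSupport.intro hK fun x hx => hψtK τ x hx)
  have hGτ : ∫ x, G (τ, x) = (∫ x, ⟪timeDerivWithin (Icc 0 T) u τ x, ψ τ x⟫) + ∫ x, ⟪u τ x, timeDeriv ψ τ x⟫ :=
    integral_add i1 i2
  rw [hGτ, hslice_id]
  -- recombine
  have hψ1 : ContDiff ℝ 1 (ψ τ) := hψ2.of_le one_le_two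
  have hfc : Continuous (f τ) := h.continuous_force_slice hU hτI
  have hcψ := hψ.hasCompactSupport_slice τ
  have iC' : Integrable (fun x => ⟪u τ x, convect (u τ) (ψ τ) x⟫) (volume : Measure E) :=
    integrable_inner_of_hasCompactSupport_right huc ((hψ1.continuous_fderiv one_ne_zero).clm_apply huc)
      ((hcψ.fderiv (𝕜 := ℝ)).mono fun x hx => by
        contrapose! hx; simp only [mem_support, not_not] at hx; simp [convect, hx])
  have iL' : Integrable (fun x => ⟪u τ x, (Δ (ψ τ)) x⟫) (volume : Measure E) :=
    integrable_inner_of_hasCompactSupport_right huc (continuous_laplacian hψ2)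
      (hcψ.mono' fun x hx => by
        contrapose! hx; simp [laplacian_eq_zero_of_notMem_tsupport hx])
  have iF : Integrable (fun x => ⟪f τ x, ψ τ x⟫) (volume : Measure E) :=
    integrable_inner_of_hasCompactSupport_right hfc (hψc.comp (Continuous.prodMk_right τ)) hcψ
  have i3 : Integrable (fun x => ⟪u τ x, convect (u τ) (ψ τ) x⟫ + ν * ⟪u τ x, (Δ (ψ τ)) x⟫ + ⟪f τ x, ψ τ x⟫)
      (volume : Measure E) := (iC'.add (iL'.const_mul ν)).add iF
  rw [← integral_add i3 i2]
  refine integral_congr_ae (Eventually.of_forall fun x => ?_)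
  ring

end General

/-! ### The regularised weak form -/

namespace FourierNS.RegSetup

open FourierNS

variable {ι : Type*} [Fintype ι] [DecidableEq ι] (d : RegSetup ι)

/-- `Ju(t)` is `C¹` in `x` for `t ∈ [0, T]`. [folklore] -/
theorem contDiff_ju {t : ℝ} (ht : t ∈ Icc 0 d.T) (n : ℕ) : ContDiff ℝ n (d.ju t) :=
  d.smooth_ju.contDiff_slice ht |> fun h => contDiff_infty.1 h n

/-- **The force pairs to the difference of the transported convective terms**: for
`t ∈ [0, T]` and a `C¹` compactly supported `ψt`,
`∫⟪f(t), ψt⟫ = ∫⟪u, (Ju·∇)ψt⟫ − ∫⟪u, (u·∇)ψt⟫` (integration by parts, `div u = div Ju = 0`). [folklore] -/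
theorem integral_inner_force {t : ℝ} (ht : t ∈ Icc 0 d.T) {ψt : EuclideanSpace ℝ ι → EuclideanSpace ℝ ι}
    (hψ : ContDiff ℝ 1 ψt) (hc : HasCompactSupport ψt) :
    ∫ x, ⟪d.force t x, ψt x⟫ = (∫ x, ⟪d.u t x, convect (d.ju t) ψt x⟫) - ∫ x, ⟪d.u t x, convect (d.u t) ψt x⟫ := by
  have hu1 : ContDiff ℝ 1 (d.u t) := contDiff_infty.1 (d.smooth_u.contDiff_slice ht) 1
  have hj1 : ContDiff ℝ 1 (d.ju t) := d.contDiff_ju ht 1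
  have huc := hu1.continuous
  have hψc := hψ.continuous
  have h1 := integral_inner_convect_add_eq_zero hu1 hu1 hψ hc
  have h2 := integral_inner_convect_add_eq_zero hj1 hu1 hψ hc
  have hz1 : ∫ x, VectorCalculus.divergence (d.u t) x * ⟪d.u t x, ψt x⟫ = 0 := by simp [d.isDivFree_u ht _]
  have hz2 : ∫ x, VectorCalculus.divergence (d.ju t) x * ⟪d.u t x, ψt x⟫ = 0 := by simp [d.isDivFree_ju ht _]
  have iC1 : Integrable (fun x => ⟪convect (d.u t) (d.u t) x, ψt x⟫) (volume : Measure (EuclideanSpace ℝ ι)) :=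
    integrable_inner_of_hasCompactSupport_right ((hu1.continuous_fderiv one_ne_zero).clm_apply huc) hψc hc
  have iC2 : Integrable (fun x => ⟪convect (d.ju t) (d.u t) x, ψt x⟫) (volume : Measure (EuclideanSpace ℝ ι)) :=
    integrable_inner_of_hasCompactSupport_right ((hu1.continuous_fderiv one_ne_zero).clm_apply hj1.continuous) hψc hc
  have hsplit : ∫ x, ⟪d.force t x, ψt x⟫ = (∫ x, ⟪convect (d.u t) (d.u t) x, ψt x⟫) - ∫ x, ⟪convect (d.ju t) (d.u t) x, ψt x⟫ := by
    rw [← integral_sub iC1 iC2]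
    refine integral_congr_ae (Eventually.of_forall fun x => ?_)
    simp only [force, inner_sub_left]
  rw [hsplit]
  linarith

/-- **Leray's regularised weak form** (Leray 1934, Ch. V §26, (5.1) paired with a test field;
Ożański–Pooley 2018, Thm. 6.33): for every space–time test field `ψ` with divergence-free slices
and `0 ≤ s ≤ t ≤ T`,
`∫⟪u(t), ψ(t)⟫ − ∫⟪u(s), ψ(s)⟫ = ∫ₛᵗ ∫ (⟪u, ∂ₜψ⟫ + ⟪u, (Ju·∇)ψ⟫ + ν ⟪u, Δψ⟫) dx dτ`. [folklore] -/
theorem regularised {ψ : ℝ → EuclideanSpace ℝ ι → EuclideanSpace ℝ ι}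
    (hψ : IsSpaceTimeTestOn (⊤ : Opens (ℝ × EuclideanSpace ℝ ι)) ψ) (hdiv : ∀ τ, VectorCalculus.IsDivFree (ψ τ))
    {s t : ℝ} (hs : 0 ≤ s) (hst : s ≤ t) (ht : t ≤ d.T) :
    (∫ x, ⟪d.u t x, ψ t x⟫) - ∫ x, ⟪d.u s x, ψ s x⟫ =
      ∫ τ in s..t, ∫ x, (⟪d.u τ x, timeDeriv ψ τ x⟫ + ⟪d.u τ x, convect (d.ju τ) (ψ τ) x⟫ +
        d.ν * ⟪d.u τ x, (Δ (ψ τ)) x⟫) := by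
  rw [d.isClassicalNSSolutionOn.integral_inner_sub_eq d.hT hψ hdiv hs hst ht]
  refine intervalIntegral.integral_congr fun τ hτ => ?_
  rw [uIcc_of_le hst] at hτ
  have hτI : τ ∈ Icc 0 d.T := ⟨hs.trans hτ.1, hτ.2.trans ht⟩
  have hψc : Continuous (uncurry ψ) := hψ.contDiff.continuous
  have hψ2 : ContDiff ℝ 2 (ψ τ) := (hψ.contDiff.comp (contDiff_prodMk_right τ)).of_le (by norm_cast)
  have hψ1 : ContDiff ℝ 1 (ψ τ) := hψ2.of_le one_le_two
  have hcψ := hψ.hasCompactSupport_slice τ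
  have huc : Continuous (d.u τ) := (contDiff_infty.1 (d.smooth_u.contDiff_slice hτI) 1 : ContDiff ℝ 1 (d.u τ)).continuous
  have hjc : Continuous (d.ju τ) := (d.contDiff_ju hτI 1).continuous
  have hcD : HasCompactSupport (fderiv ℝ (ψ τ)) := hcψ.fderiv (𝕜 := ℝ)
  have iC : ∀ {w : EuclideanSpace ℝ ι → EuclideanSpace ℝ ι}, Continuous w →
      Integrable (fun x => ⟪d.u τ x, convect w (ψ τ) x⟫) (volume : Measure (EuclideanSpace ℝ ι)) := fun {w} hw =>
    integrable_inner_of_hasCompactSupport_right huc ((hψ1.continuous_fderiv one_ne_zero).clm_apply hw)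
      (hcD.mono fun x hx => by contrapose! hx; simp only [mem_support, not_not] at hx; simp [convect, hx])
  have iT : Integrable (fun x => ⟪d.u τ x, timeDeriv ψ τ x⟫) (volume : Measure (EuclideanSpace ℝ ι)) :=
    integrable_inner_of_hasCompactSupport_right huc (hψ.continuous_timeDeriv.comp (Continuous.prodMk_right τ))
      (by
        obtain ⟨K, hK, hKt⟩ := hψ.exists_compact_slice_subset
        exact HasCompactSupport.intro hK fun x hx => timeDeriv_eq_zero_of_forall
          (fun σ => image_eq_zero_of_notMem_tsupport fun h' => hx (hKt σ h')) τ)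
  have iL : Integrable (fun x => d.ν * ⟪d.u τ x, (Δ (ψ τ)) x⟫) (volume : Measure (EuclideanSpace ℝ ι)) :=
    (integrable_inner_of_hasCompactSupport_right huc (continuous_laplacian hψ2)
      (hcψ.mono' fun x hx => by contrapose! hx; simp [laplacian_eq_zero_of_notMem_tsupport hx])).const_mul _
  have iF : Integrable (fun x => ⟪d.force τ x, ψ τ x⟫) (volume : Measure (EuclideanSpace ℝ ι)) :=
    integrable_inner_of_hasCompactSupport_right (d.isClassicalNSSolutionOn.continuous_force_slice (uniqueDiffOn_Icc d.hT) hτI)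
      (hψc.comp (Continuous.prodMk_right τ)) hcψ
  have iTCu : Integrable (fun x => ⟪d.u τ x, timeDeriv ψ τ x⟫ + ⟪d.u τ x, convect (d.u τ) (ψ τ) x⟫)
      (volume : Measure (EuclideanSpace ℝ ι)) := iT.add (iC huc)
  have iTCuL : Integrable (fun x => ⟪d.u τ x, timeDeriv ψ τ x⟫ + ⟪d.u τ x, convect (d.u τ) (ψ τ) x⟫ +
      d.ν * ⟪d.u τ x, (Δ (ψ τ)) x⟫) (volume : Measure (EuclideanSpace ℝ ι)) := iTCu.add iL
  have iTCj : Integrable (fun x => ⟪d.u τ x, timeDeriv ψ τ x⟫ + ⟪d.u τ x, convect (d.ju τ) (ψ τ) x⟫)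
      (volume : Measure (EuclideanSpace ℝ ι)) := iT.add (iC hjc)
  rw [integral_add iTCuL iF, integral_add iTCu iL, integral_add iT (iC huc), integral_add iTCj iL, integral_add iT (iC hjc),
    d.integral_inner_force hτI hψ1 hcψ]
  ring

end FourierNS.RegSetup

end Literature.Analysis.FluidPDE

end
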